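import Mathlib
import HarnessLib

/-!
# Convergence of DISTRIBUTION FUNCTIONS at every point implies convergence IN DISTRIBUTION:
# `P(Tₙ ≤ x) → P(Z ≤ x)` for all real `x` ⇒ `Tₙ ⇒ Z` — the converse packaging that turns a
# "distribution-function form" limit theorem into a `TendstoInDistribution` statement

HONEST FRAMING: exact (Metropolis-corrected) sampling algorithms for lattice gauge theory;
figures of merit are autocorrelation/cost numbers at stated couplings and volumes; no
continuum-physics claim.

Venture `LatticeQCDFlow` (cell pub-lqcd), topic `Scoring`; FANOUT row 4 (`s0-u1-b`, rung S0-B).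
`Scoring/SampleQuantileCLT` states the sample-quantile central limit theorem in
distribution-function form (`P(√n(q̂ₙ − q) ≤ x) → …` for every `x`); `Scoring/AsymptoticCoverage`
goes the other way (continuity sets of a limit in distribution).  This file proves the classical
converse on `ℝ`: if the distribution functions of real statistics `Tₙ` converge at EVERY point
to that of `Z`, then `Tₙ ⇒ Z` (**`tendstoInDistribution_of_tendsto_cdf`**).  Proof: Mathlib's
π-system convergence criterion `IsPiSystem.tendsto_probabilityMeasure_of_tendsto_of_mem` with
the π-system of half-open intervals `(a, b]`, whose probabilities are differences of
distribution-function values and which contain small neighbourhoods of every point.  No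
atomlessness is assumed (convergence at every point is the hypothesis).  NEW WORK of the cell
(classical; our formalisation — Mathlib has the π-system criterion, not this corollary); no
definition; nothing cited as a fact.

## Content

* `measureReal_preimage_Ioc_eq` — `P(Tₙ ∈ (a, b]) = P(Tₙ ≤ b) − P(Tₙ ≤ a)`;
* **`tendstoInDistribution_of_tendsto_cdf`**.

NOT CLAIMED: convergence only at continuity points of the limit (the sharp portmanteau
converse); random vectors.
-/

noncomputable section

namespace Summit.Ventures.LatticeQCDFlow.Scoring.CardConsistency

open MeasureTheory ProbabilityTheory Filter Set
open scoped Topology ENNReal NNReal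

variable {Ω : Type*} [MeasurableSpace Ω] {P : Measure Ω} [IsProbabilityMeasure P]
variable {Ω' : Type*} [MeasurableSpace Ω'] {P' : Measure Ω'} [IsProbabilityMeasure P']

omit [IsProbabilityMeasure P] in
/-- `P(T ∈ (a, b]) = P(T ≤ b) − P(T ≤ a)` for `a ≤ b` and an a.e.-measurable real `T` (finite
measure). [folklore] -/
theorem measureReal_preimage_Ioc_eq [IsFiniteMeasure P] {T : Ω → ℝ} (hT : AEMeasurable T P)
    {a b : ℝ} (hab : a ≤ b) :
    (P.map T).real (Ioc a b) = P.real {ω | T ω ≤ b} - P.real {ω | T ω ≤ a} := by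
  rw [← Iic_sdiff_Iic, measureReal_sdiff (Iic_subset_Iic.2 hab) measurableSet_Iic,
    measureReal_def, measureReal_def, Measure.map_apply_of_aemeasurable hT measurableSet_Iic,
    Measure.map_apply_of_aemeasurable hT measurableSet_Iic]
  rfl

/-- **CONVERGENCE OF DISTRIBUTION FUNCTIONS AT EVERY POINT IMPLIES CONVERGENCE IN
DISTRIBUTION.**  Real statistics `Tₙ` (a.e.-measurable) on `(Ω, P)` and `Z` on `(Ω', P')`; if
`P(Tₙ ≤ x) → P'(Z ≤ x)` for every real `x`, then `Tₙ ⇒ Z`. [ours] (π-system of half-open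
intervals; Mathlib's `IsPiSystem.tendsto_probabilityMeasure_of_tendsto_of_mem`) -/
theorem tendstoInDistribution_of_tendsto_cdf {T : ℕ → Ω → ℝ} {Z : Ω' → ℝ}
    (hT : ∀ n, AEMeasurable (T n) P) (hZ : AEMeasurable Z P')
    (h : ∀ x : ℝ, Tendsto (fun n => P.real {ω | T n ω ≤ x}) atTop (𝓝 (P'.real {ω' | Z ω' ≤ x}))) :
    TendstoInDistribution T atTop Z (fun _ => P) P' := by
  refine ⟨hT, hZ, ?_⟩
  -- the π-system of half-open intervals
  have hS : IsPiSystem {S : Set ℝ | ∃ i j : ℝ, i < j ∧ Ioc (id i) (id j) = S} :=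
    isPiSystem_Ioc (id : ℝ → ℝ) (id : ℝ → ℝ)
  refine hS.tendsto_probabilityMeasure_of_tendsto_of_mem (fun s hs => ?_) (fun u hu x hx => ?_)
    (fun s hs => ?_)
  · obtain ⟨i, j, -, rfl⟩ := hs
    exact measurableSet_Ioc
  · -- small neighbourhoods: `(x − ε, x + ε] ∈ 𝓝 x`, inside `u`
    obtain ⟨ε, hε, hball⟩ := Metric.isOpen_iff.1 hu x hx
    refine ⟨Ioc (x - ε / 2) (x + ε / 2), ⟨x - ε / 2, x + ε / 2, by linarith, rfl⟩, ?_, ?_⟩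
    · exact mem_of_superset (Ioo_mem_nhds (by linarith) (by linarith)) Ioo_subset_Ioc_self
    · intro y hy
      apply hball
      rw [Metric.mem_ball, Real.dist_eq, abs_lt]
      constructor <;> linarith [hy.1, hy.2]
  · -- convergence on `(a, b]`: differences of distribution-function values
    obtain ⟨a, b, hab, rfl⟩ := hs
    simp only [id] at hab ⊢
    rw [← ENNReal.tendsto_coe]
    simp only [ProbabilityMeasure.ennreal_coeFn_eq_coeFn_toMeasure, ProbabilityMeasure.coe_mk]
    rw [← ENNReal.tendsto_toReal_iff (fun n => measure_ne_top _ _) (measure_ne_top _ _)]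
    have e : ∀ n, ((P.map (T n)) (Ioc a b)).toReal = P.real {ω | T n ω ≤ b} - P.real {ω | T n ω ≤ a} :=
      fun n => by rw [← measureReal_def, measureReal_preimage_Ioc_eq (hT n) hab.le]
    have eZ : ((P'.map Z) (Ioc a b)).toReal = P'.real {ω' | Z ω' ≤ b} - P'.real {ω' | Z ω' ≤ a} := by
      rw [← measureReal_def, measureReal_preimage_Ioc_eq hZ hab.le]
    simp_rw [e, eZ]
    exact (h b).sub (h a)

end Summit.Ventures.LatticeQCDFlow.Scoring.CardConsistency

end
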